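import Summits.CriticalPhenomena.PercolationContinuityZ3.Theorems.PercNearOneGluingNoHeavyLowerTailChampionStability
import Summits.CriticalPhenomena.PercolationContinuityZ3.Theorems.PercNearOneGluingNoHeavyLowerTailRelayNeighbourhoodGluing
import Literature.Probability.Percolation.LonelyClusterExchange
import HarnessLib

/-!
# `NoHeavyLowerTail` (stmt-CriticalPhenomena-4575) — merge stability at RELAY gluings (unconditional) and the
# cumulative isolation lemma with the champion as witness for relay-neighbour observers

Seat `prim-gen-swap` (gen 1), 2026-08-18.  `μ_w = prodBernoulli w` on `Fin n`, relays `A`, observer `o ∉ A`, level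
`j`, `π(v) = {x ∈ A : v ↔ x}`, `L = {1 ≤ |π(o)| ≤ j}`, `R_a = {|π(a)| ≤ j}`, champion `c ∈ argmax_A μ(R_·)`.

* `CILOneSteiner.mergeStability_at_relay` — the registered `stub_mergeStability` RESTRICTED TO RELAY GLUINGS is a
  theorem: if `w s(o,v) = 0`, `v ∈ A` and `c` is a champion of `w`, then `μ_{w[s(o,v)↦1]}(L) ≤ μ_{w[s(o,v)↦1]}(R_c)`.
  From the tree's two-observer transfer `twoObserver_le_of_lonelier` (van den Berg–Häggström–Kahn Thm 1.5) by the
  pull-back computation of `mergeStability_of_championStabilityPair`.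
* `CILOneSteiner.cil_champion_of_relayNeighbours` — if every positive-weight pair at `o` goes to a relay, then
  `μ(L) ≤ μ(R_c)` for EVERY champion `c` of the same graph (induction on the positive pairs at `o`, one-bond
  decomposition `stub_oneBondDecomp_k15`, merge stability at relay gluings).  Cf. `cil_relayNeighbours` (prim-gen-induct,
  witness = a port) and [KozmaNitzan2024, Thm 4]; the champion witness is what the one-Steiner extension
  `…CILOneSteiner.lean` needs.
-/

noncomputable section

namespace Summit.CriticalPhenomena.PercolationContinuityZ3.Theorems

open MeasureTheory Set Literature.Probability.LatticeModels Literature.Probability.Percolation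
open scoped Classical BigOperators

variable {n : ℕ}

namespace CILOneSteiner

open ChampionStability MergeStability

/-- **Merge stability at a relay gluing** (unconditional).  `w s(o,v) = 0`, `v ∈ A`, `c` a champion of `w`
`⇒ μ_{w[s(o,v)↦1]}(L) ≤ μ_{w[s(o,v)↦1]}(R_c)`.  [cite: VandenbergHaggstromKahn2005, Thm. 1.5 (p. 7) — via
`twoObserver_le_of_lonelier`] -/
theorem mergeStability_at_relay (w : Sym2 (Fin n) → unitInterval) (A : Finset (Fin n)) (o v c : Fin n) (j : ℕ)
    (ho : o ∉ A) (hvA : v ∈ A) (hc : c ∈ A) (hw : w s(o, v) = 0)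
    (hchamp : ∀ a ∈ A,
      (prodBernoulli w).real {ω : BondConfig (Fin n) | (A.filter fun x => ω ∈ openConn a x).card ≤ j} ≤
        (prodBernoulli w).real {ω : BondConfig (Fin n) | (A.filter fun x => ω ∈ openConn c x).card ≤ j}) :
    (prodBernoulli (Function.update w s(o, v) 1)).real {ω : BondConfig (Fin n) |
        1 ≤ (A.filter fun x => ω ∈ openConn o x).card ∧ (A.filter fun x => ω ∈ openConn o x).card ≤ j} ≤
      (prodBernoulli (Function.update w s(o, v) 1)).real {ω : BondConfig (Fin n) |
        (A.filter fun x => ω ∈ openConn c x).card ≤ j} := by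
  have hvo : v ≠ o := fun h => ho (h ▸ hvA)
  have hov : o ≠ v := fun h => hvo h.symm
  set μ₁ := prodBernoulli (Function.update w s(o, v) 1) with hμ₁
  set L₁ : Set (BondConfig (Fin n)) := {ω | 1 ≤ (A.filter fun x => ω ∈ openConn o x).card ∧
      (A.filter fun x => ω ∈ openConn o x).card ≤ j} with hL₁
  set R₁ : Set (BondConfig (Fin n)) := {ω | (A.filter fun x => ω ∈ openConn c x).card ≤ j} with hR₁
  set C : Set (BondConfig (Fin n)) := openConn o c with hC
  have hsplit : ∀ S : Set (BondConfig (Fin n)), μ₁.real S = μ₁.real (S ∩ C) + μ₁.real (S \ C) :=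
    fun S => (measureReal_inter_add_sdiff (μ := μ₁) (s := S) (Set.toFinite C).measurableSet).symm
  have hLC : L₁ ∩ C = R₁ ∩ C := by
    ext ω
    simp only [hL₁, hR₁, hC, mem_inter_iff, mem_setOf_eq]
    constructor
    · rintro ⟨⟨-, h2⟩, hoc⟩
      have hoc' : (openGraph ω).Reachable o c := hoc
      have heq : (A.filter fun x => ω ∈ openConn c x) = (A.filter fun x => ω ∈ openConn o x) := by
        refine Finset.filter_congr fun x _ => ⟨fun h => ?_, fun h => ?_⟩
        · exact hoc'.trans h
        · exact hoc'.symm.trans h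
      rw [heq]
      exact ⟨h2, hoc⟩
    · rintro ⟨h2, hoc⟩
      have hoc' : (openGraph ω).Reachable o c := hoc
      have heq : (A.filter fun x => ω ∈ openConn o x) = (A.filter fun x => ω ∈ openConn c x) := by
        refine Finset.filter_congr fun x _ => ⟨fun h => ?_, fun h => ?_⟩
        · exact hoc'.symm.trans h
        · exact hoc'.trans h
      rw [heq]
      refine ⟨⟨Finset.card_pos.2 ⟨c, Finset.mem_filter.2 ⟨hc, ?_⟩⟩, h2⟩, hoc⟩
      exact SimpleGraph.Reachable.refl c
  have hLoff : μ₁.real (L₁ \ C) = (prodBernoulli w).real {ω : BondConfig (Fin n) |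
      ω ∉ openConn c o ∧ ω ∉ openConn c v ∧
      1 ≤ (A.filter fun z => ω ∈ openConn o z ∨ ω ∈ openConn v z).card ∧
      (A.filter fun z => ω ∈ openConn o z ∨ ω ∈ openConn v z).card ≤ j} := by
    rw [hμ₁, real_update_one_eq w hw]
    congr 1
    ext ω
    simp only [hL₁, hC, mem_preimage, Set.mem_sdiff, mem_setOf_eq]
    have hfilt : (A.filter fun x => insert s(o, v) ω ∈ openConn o x) =
        (A.filter fun z => ω ∈ openConn o z ∨ ω ∈ openConn v z) := by
      refine Finset.filter_congr fun x _ => ?_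
      exact reachable_insert_left_iff ω hov x
    have hco : insert s(o, v) ω ∈ openConn o c ↔ (ω ∈ openConn c o ∨ ω ∈ openConn c v) := by
      show (openGraph (insert s(o, v) ω)).Reachable o c ↔
        ((openGraph ω).Reachable c o ∨ (openGraph ω).Reachable c v)
      rw [SimpleGraph.reachable_comm]
      exact reachable_insert_to_left_iff ω hov c
    rw [hfilt, hco]
    tauto
  have hRoff : μ₁.real (R₁ \ C) = (prodBernoulli w).real {ω : BondConfig (Fin n) |
      ω ∉ openConn c o ∧ ω ∉ openConn c v ∧ (A.filter fun z => ω ∈ openConn c z).card ≤ j} := by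
    rw [hμ₁, real_update_one_eq w hw]
    congr 1
    ext ω
    simp only [hR₁, hC, mem_preimage, Set.mem_sdiff, mem_setOf_eq]
    have hco : insert s(o, v) ω ∈ openConn o c ↔ (ω ∈ openConn c o ∨ ω ∈ openConn c v) := by
      show (openGraph (insert s(o, v) ω)).Reachable o c ↔
        ((openGraph ω).Reachable c o ∨ (openGraph ω).Reachable c v)
      rw [SimpleGraph.reachable_comm]
      exact reachable_insert_to_left_iff ω hov c
    rw [hco]
    constructor
    · rintro ⟨hcard, hnot⟩
      have hco' : ¬ (openGraph ω).Reachable c o := fun h => hnot (Or.inl h)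
      have hcv' : ¬ (openGraph ω).Reachable c v := fun h => hnot (Or.inr h)
      have hfilt : (A.filter fun x => insert s(o, v) ω ∈ openConn c x) =
          (A.filter fun z => ω ∈ openConn c z) := by
        refine Finset.filter_congr fun x _ => ?_
        exact reachable_insert_iff_of_not ω hov hco' hcv' x
      rw [hfilt] at hcard
      exact ⟨hco', hcv', hcard⟩
    · rintro ⟨hco', hcv', hcard⟩
      have hfilt : (A.filter fun x => insert s(o, v) ω ∈ openConn c x) =
          (A.filter fun z => ω ∈ openConn c z) := by
        refine Finset.filter_congr fun x _ => ?_
        exact reachable_insert_iff_of_not ω hov hco' hcv' x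
      rw [hfilt]
      exact ⟨hcard, fun h => h.elim hco' hcv'⟩
  have key := twoObserver_le_of_lonelier w A o v c j (hchamp v hvA)
  rw [hsplit L₁, hsplit R₁, hLC, hLoff, hRoff]
  linarith

/-- Zeroing one pair keeps zero weights zero. [folklore] -/
theorem update_zero_apply_eq_zero (w : Sym2 (Fin n) → unitInterval) (e e' : Sym2 (Fin n))
    (h : (w e' : ℝ) = 0) : ((Function.update w e 0 e' : unitInterval) : ℝ) = 0 := by
  by_cases hee : e' = e
  · subst hee; simp
  · rw [Function.update_of_ne hee]; exact h

/-- **CIL with the champion as witness, for observers all of whose positive-weight neighbours are relays.**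
Induction on the number of positive pairs at `o`; each step is merge stability at a relay gluing.
[cite: KozmaNitzan2024, Thm 4 (p. 12) — CIL analogue] -/
theorem cil_champion_of_relayNeighbours (A : Finset (Fin n)) (o : Fin n) (j : ℕ) (ho : o ∉ A) :
    ∀ (m : ℕ) (w : Sym2 (Fin n) → unitInterval),
      (Finset.univ.filter fun v : Fin n => v ≠ o ∧ 0 < (w s(o, v) : ℝ)).card = m →
      (∀ v : Fin n, v ≠ o → v ∉ A → (w s(o, v) : ℝ) = 0) →
      ∀ c ∈ A, (∀ a ∈ A,
        (prodBernoulli w).real {ω : BondConfig (Fin n) | (A.filter fun x => ω ∈ openConn a x).card ≤ j} ≤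
          (prodBernoulli w).real {ω : BondConfig (Fin n) | (A.filter fun x => ω ∈ openConn c x).card ≤ j}) →
      (prodBernoulli w).real {ω : BondConfig (Fin n) |
          1 ≤ (A.filter fun x => ω ∈ openConn o x).card ∧ (A.filter fun x => ω ∈ openConn o x).card ≤ j} ≤
        (prodBernoulli w).real {ω : BondConfig (Fin n) | (A.filter fun x => ω ∈ openConn c x).card ≤ j} := by
  intro m
  induction m with
  | zero =>
    intro w hm _ c hc _
    have hw : ∀ v : Fin n, v ≠ o → (w s(o, v) : ℝ) = 0 := by
      intro v hv
      by_contra hne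
      have hpos : 0 < (w s(o, v) : ℝ) := lt_of_le_of_ne (w s(o, v)).2.1 (Ne.symm hne)
      have hmem : v ∈ (Finset.univ.filter fun v : Fin n => v ≠ o ∧ 0 < (w s(o, v) : ℝ)) :=
        Finset.mem_filter.2 ⟨Finset.mem_univ _, hv, hpos⟩
      rw [Finset.card_eq_zero] at hm
      rw [hm] at hmem
      exact Finset.notMem_empty v hmem
    rw [real_L_eq_zero_of_isolated w A o j ho hw]
    exact measureReal_nonneg
  | succ m ih =>
    intro w hm hrel c hc hchampw
    obtain ⟨v, hv⟩ := Finset.card_pos.1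
      (by omega : 0 < (Finset.univ.filter fun v : Fin n => v ≠ o ∧ 0 < (w s(o, v) : ℝ)).card)
    obtain ⟨-, hvo, hvpos⟩ := Finset.mem_filter.1 hv
    have hvA : v ∈ A := by
      by_contra hvA
      have := hrel v hvo hvA
      linarith
    set e : Sym2 (Fin n) := s(o, v) with he
    set w₀ : Sym2 (Fin n) → unitInterval := Function.update w e 0 with hw₀
    set w₁ : Sym2 (Fin n) → unitInterval := Function.update w e 1 with hw₁
    have hcount : (Finset.univ.filter fun u : Fin n => u ≠ o ∧ 0 < (w₀ s(o, u) : ℝ)).card = m := by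
      have hset : (Finset.univ.filter fun u : Fin n => u ≠ o ∧ 0 < (w₀ s(o, u) : ℝ)) =
          (Finset.univ.filter fun u : Fin n => u ≠ o ∧ 0 < (w s(o, u) : ℝ)).erase v := by
        ext u
        simp only [Finset.mem_filter, Finset.mem_univ, true_and, Finset.mem_erase]
        by_cases huv : u = v
        · subst huv
          simp [hw₀, he]
        · have hne : s(o, u) ≠ e := by
            rw [he]
            intro h
            exact huv (Sym2.congr_right.1 h)
          simp [hw₀, Function.update_of_ne hne, huv]
      rw [hset, Finset.card_erase_of_mem hv, hm]
      rfl
    have hrel₀ : ∀ u : Fin n, u ≠ o → u ∉ A → (w₀ s(o, u) : ℝ) = 0 :=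
      fun u hu huA => update_zero_apply_eq_zero w e _ (hrel u hu huA)
    obtain ⟨c₀, hc₀, hchamp₀⟩ := exists_champion (prodBernoulli w₀) A ⟨c, hc⟩ j
    have hL₀ := ih w₀ hcount hrel₀ c₀ hc₀ hchamp₀
    have hw₀e : w₀ s(o, v) = 0 := by simp [hw₀, he]
    have hMS := mergeStability_at_relay w₀ A o v c₀ j ho hvA hc₀ hw₀e hchamp₀
    have hw₁eq : Function.update w₀ s(o, v) 1 = w₁ := by
      rw [hw₀, hw₁, he, Function.update_idem]
    rw [hw₁eq] at hMS
    have hp0 : 0 ≤ (w e : ℝ) := (w e).2.1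
    have hp1 : (w e : ℝ) ≤ 1 := (w e).2.2
    have hRc : (prodBernoulli w).real {ω : BondConfig (Fin n) | (A.filter fun x => ω ∈ openConn c₀ x).card ≤ j} ≤
        (prodBernoulli w).real {ω : BondConfig (Fin n) | (A.filter fun x => ω ∈ openConn c x).card ≤ j} :=
      hchampw c₀ hc₀
    refine le_trans ?_ hRc
    rw [stub_oneBondDecomp_k15 n w e {ω : BondConfig (Fin n) |
        1 ≤ (A.filter fun x => ω ∈ openConn o x).card ∧ (A.filter fun x => ω ∈ openConn o x).card ≤ j},
      stub_oneBondDecomp_k15 n w e {ω : BondConfig (Fin n) |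
        (A.filter fun x => ω ∈ openConn c₀ x).card ≤ j}]
    have h0 : (1 - (w e : ℝ)) * (prodBernoulli w₀).real {ω : BondConfig (Fin n) |
          1 ≤ (A.filter fun x => ω ∈ openConn o x).card ∧ (A.filter fun x => ω ∈ openConn o x).card ≤ j} ≤
        (1 - (w e : ℝ)) * (prodBernoulli w₀).real {ω : BondConfig (Fin n) |
          (A.filter fun x => ω ∈ openConn c₀ x).card ≤ j} :=
      mul_le_mul_of_nonneg_left hL₀ (by linarith)
    have h1 : (w e : ℝ) * (prodBernoulli w₁).real {ω : BondConfig (Fin n) |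
          1 ≤ (A.filter fun x => ω ∈ openConn o x).card ∧ (A.filter fun x => ω ∈ openConn o x).card ≤ j} ≤
        (w e : ℝ) * (prodBernoulli w₁).real {ω : BondConfig (Fin n) |
          (A.filter fun x => ω ∈ openConn c₀ x).card ≤ j} :=
      mul_le_mul_of_nonneg_left hMS hp0
    exact add_le_add h0 h1

end CILOneSteiner

end Summit.CriticalPhenomena.PercolationContinuityZ3.Theorems

end
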